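import Summits.ResolutionOfSingularities.ResolutionOfSingularities.Theorems.WeightedInvariantE2HomogeneousChartDefs
import Summits.ResolutionOfSingularities.ResolutionOfSingularities.Theorems.WeightedInvariantELadderTwoCentreAssembly
import HarnessLib

/-!
# SPEC (Δ11b) SCHEME-LEVEL WORDS, VERBATIM — (G-6) `E2CentreHomBody` and the scheme glue target `E2CentreSchemeGlueBody`
# (registrar res-L1-w43-plan-1, `L/res-L1-w43-plan-1/E2Step_split_sketch.lean` rev 10 sha16 89cfa54f1710b67e l.655–716; DEALER LINES g15 #1
# 2026-08-27T20:07:49Z «048 files the rev-10 word»; the ring-level words are res-L1-s36-pv-1's `…E2HomogeneousChartDefs`)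

[OURS · L1 W4.3 · DOOR `HypersurfaceCentreConstruction` stmt-ResolutionOfSingularities-19897 · E2 tier, centre piece (C-c) `E2CentreGlueBody`,
DESIGN MEMO v0 `L/res-L1-w43-plan-1/E2-CENTRE-GLUE-DESIGN-v0.md` §3; typer = the scheme hand res-D-pv-048 (gen 11) at the registrar's word.
Candidate DEFINITIONS (design objects of the line) + two trivial seams; nothing is asserted; nothing here is a statement of, or about, the
manuscript under adjudication (Hironaka 2017, [claim: Hironaka2017, status: under-review]); AI planning/typing, weaker than expert review.]

Contents (registrar's anchors in the sketch): (G-6) `E2CentreHomBody p ι J` (l.669, board item (o47-hom): the `(hom)` clause of `IsAdmissibleCentre`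
for EVERY grading, at the stalkwise-maximal canonical e = 2 centre) · `E2CentreSchemeGlueBody p ι J` (l.687, board item (o47-c-scheme), res-D-pv-048's
target: `PRungGrHomLE 3 p ι J → E2HomogeneousChartBody p ι J → E2CentreHomBody p ι J → E2CentreGlueBody p ι J`) · the glue
`e2CentreGlue_of_homChart_hom_scheme` (l.693, PROVED) · the uniqueness seam `piece_eq_of_maximal` (l.706, PROVED).  The ring-level words
`JOpenBodyLE3Hom` / `E2HomogeneousChartBody` are imported from `…E2HomogeneousChartDefs`, the conclusion `E2CentreGlueBody` from 031's
`…ELadderTwoCentreAssembly`.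
-/

noncomputable section

set_option linter.dupNamespace false

open CategoryTheory AlgebraicGeometry TopologicalSpace IsLocalRing
open Literature.AlgebraicGeometry.Resolution
open Summit.ResolutionOfSingularities.ResolutionOfSingularities.Theorems
open Summit.ResolutionOfSingularities.ResolutionOfSingularities.Theorems.ELadderOne

namespace Summit.ResolutionOfSingularities.ResolutionOfSingularities.Cruxes.HypersurfaceCentreConstruction.LocalEngine

/-- (G-6) **(hom) FOR EVERY GRADING OF THE MAXIMAL CANONICAL e = 2 CENTRE = board item (o47-hom)** (SPEC (Δ11b), rev 10; res-D-pv-048's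
CUT 19:52:52Z, registrar ACCEPTED; size M–L; memo `E2-CENTRE-GLUE-DESIGN-v0.md` §3 (G-6)).  For a canonical e = 2 centre `R` which is degreewise
the LARGEST ideal sheaf below `J(𝒪_{Y,η}, f_η)` on the maximum locus (`IsCanonicalCentre₂` + stalkwise maximality — this pins `R` down uniquely and
is what (G-1)…(G-5) deliver: F1 `LocalModelSheaf.exists_idealSheafData_glue`'s maximality clause + (M2) `(U)`-primarity of the local models at the
generic points), the third clause `(hom)` of `IsAdmissibleCentre` (…HypersurfaceAdmissibleSequences l.57) holds VERBATIM: on EVERY affine open `W`,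
for EVERY `ℤʲ'`-grading of `Γ(Y, W)` with the constants in degree `0` making `X(W)` homogeneous, every piece `Rₙ(W)` is homogeneous.  Mechanism =
E1's (…OrbitCentreHomogeneousMaxSing / …HomogeneousBaseChange): the constraint set and `ι`, `J` are invariant under the generic torus translate of
`𝒜` ((c11)≤3 + iso/unit invariance of the rung — the hand's target carries `PRungGrHomLE 3 p ι J`), so the largest sheaf is coaction-stable.
CHEAPEST FALSIFIER (run first): is `maxLocus₂ ι ∩ W` (orbit-genericity is relative to the STAGE atlas) stable under the torus of an ARBITRARY such
`𝒜` — `j = 0` yes (closed points); `j ≥ 1`: replace it by the intrinsic `M₃ := {y | dim 𝒪_{Y,y} ≤ 3, f_y ∈ 𝔪_y², ι = mu₂}` of memo §3 and show the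
two constraint sets define the same largest sheaf (localisation is transitive; one constraint point per component of `V(U) ∩ D(h)` suffices).
FALLBACK (F-hom-atlas, registrar): if the ∀-grading clause resists, admissibility's `(hom)` is re-cut to the stage atlas's unit charts (what
(S-b1′) `e2InducedAtlas_cover` consumes) in a v3.12 skeleton — a door-level re-typing, not free. [OURS · candidate · registrar SPEC (Δ11b)] [folklore] -/
def E2CentreHomBody (p : ℕ) (ι : (R : Type) → [CommRing R] → R → Ordinal.{0})
    (J : (R : Type) → [CommRing R] → R → ℕ → Ideal R) : Prop :=
  ∀ ⦃k : Type⦄ [Field k] [CharP k p] [PerfectField k] (S : Stage k), S.InvDim₂ → ¬ Scheme.IsRegular S.X →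
    ∀ (R : ReesAlgebraData S.Y), S.IsCanonicalCentre₂ ι J R →
    (∀ (n : ℕ) (K : S.Y.IdealSheafData),
      (∀ η ∈ S.maxLocus₂ ι, stalkIdeal K η ≤ J (S.Y.presheaf.stalk η) (localGenerator S.i.ker η) n) → K ≤ R.piece n) →
    ∀ (j : ℕ) (W : S.Y.affineOpens) (𝒜 : (Fin j → ℤ) → AddSubgroup Γ(S.Y, W)) [GradedRing 𝒜],
      (∀ c : Γ(Spec (.of k), ⊤), S.f.appLE ⊤ W le_top c ∈ 𝒜 0) → (S.i.ker.ideal W).IsHomogeneous 𝒜 →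
      ∀ n : ℕ, ((R.piece n).ideal W).IsHomogeneous 𝒜

/-- (G-1)…(G-5) **SCHEME GLUE GIVEN THE HOMOGENEOUS CHARTS AND (hom) = board item (o47-c-scheme), res-D-pv-048 WHOLE** (rev 10: the rev-9 word
of this name RE-TYPED with the extra hypothesis `E2CentreHomBody`; memo §3; size L): finite cover of `M = closure maxLocus₂` by homogeneous model
charts (`E2HomogeneousChartBody`), agreement on overlaps by the (M2) tool (res-L1-s36-pv-1 p561682), the global `ReesAlgebraData` by F1/F2a
(`LocalModelSheaf.exists_idealSheafData_glue` p564332 / `exists_reesAlgebraData_of_localModels`), stalks/support (`IsCanonicalCentre₂`) WITH the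
stalkwise maximality, regular weighted centre via (reg) + `support ⊆ singImage` locally, and `(hom)` for every grading IMPORTED from
`E2CentreHomBody` at the maximal canonical centre just built.  Conclusion = 031's tree def `LocalEngine.E2CentreGlueBody` (…ELadderTwoCentreAssembly
p564193) by name once imported.  (If the rev-9 two-hypothesis word of this name was landed by a default filing, 048 lands this text as
`E2CentreSchemeGlueBody'`.) [OURS · candidate · registrar SPEC (Δ11b)] [folklore] -/
def E2CentreSchemeGlueBody (p : ℕ) (ι : (R : Type) → [CommRing R] → R → Ordinal.{0})
    (J : (R : Type) → [CommRing R] → R → ℕ → Ideal R) : Prop :=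
  PRungGrHomLE 3 p ι J → E2HomogeneousChartBody p ι J → E2CentreHomBody p ι J → E2CentreGlueBody p ι J

/-- **GLUE (PROVED, trivially): (G-0) + (G-6) + the scheme glue give the (C-c) hand `hc` of `stub_e2_centre_h_of_pieces`** (three hands; rev 10).
[OURS · registrar SPEC (Δ11b)] -/
theorem e2CentreGlue_of_homChart_hom_scheme
    (hG0 : ∀ p : ℕ, p.Prime → ∀ (ι : (R : Type) → [CommRing R] → R → Ordinal.{0})
      (J : (R : Type) → [CommRing R] → R → ℕ → Ideal R), PRungGrHomLE 3 p ι J → E2HomogeneousChartBody p ι J)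
    (hG6 : ∀ p : ℕ, p.Prime → ∀ (ι : (R : Type) → [CommRing R] → R → Ordinal.{0})
      (J : (R : Type) → [CommRing R] → R → ℕ → Ideal R), PRungGrHomLE 3 p ι J → E2CentreHomBody p ι J)
    (hSch : ∀ p : ℕ, p.Prime → ∀ (ι : (R : Type) → [CommRing R] → R → Ordinal.{0})
      (J : (R : Type) → [CommRing R] → R → ℕ → Ideal R), E2CentreSchemeGlueBody p ι J) :
    ∀ p : ℕ, p.Prime → ∀ (ι : (R : Type) → [CommRing R] → R → Ordinal.{0})
      (J : (R : Type) → [CommRing R] → R → ℕ → Ideal R), PRungGrHomLE 3 p ι J → E2CentreGlueBody p ι J :=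
  fun p hp ι J hr => hSch p hp ι J hr (hG0 p hp ι J hr) (hG6 p hp ι J hr)

/-- **UNIQUENESS SEAM (PROVED): two degreewise-maximal canonical e = 2 centres have the same pieces** — so `E2CentreHomBody` speaks about ONE
intrinsic object per stage. [OURS · registrar SPEC (Δ11b)] [folklore] -/
theorem piece_eq_of_maximal {k : Type} [Field k] (ι : (R : Type) → [CommRing R] → R → Ordinal.{0})
    (J : (R : Type) → [CommRing R] → R → ℕ → Ideal R) (S : Stage k) {R R' : ReesAlgebraData S.Y}
    (hR : S.IsCanonicalCentre₂ ι J R) (hR' : S.IsCanonicalCentre₂ ι J R')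
    (hmax : ∀ (n : ℕ) (K : S.Y.IdealSheafData),
      (∀ η ∈ S.maxLocus₂ ι, stalkIdeal K η ≤ J (S.Y.presheaf.stalk η) (localGenerator S.i.ker η) n) → K ≤ R.piece n)
    (hmax' : ∀ (n : ℕ) (K : S.Y.IdealSheafData),
      (∀ η ∈ S.maxLocus₂ ι, stalkIdeal K η ≤ J (S.Y.presheaf.stalk η) (localGenerator S.i.ker η) n) → K ≤ R'.piece n)
    (n : ℕ) : R.piece n = R'.piece n :=
  le_antisymm (hmax' n _ fun η hη => (hR.stalkIdeal_eq η hη n).le) (hmax n _ fun η hη => (hR'.stalkIdeal_eq η hη n).le)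

end Summit.ResolutionOfSingularities.ResolutionOfSingularities.Cruxes.HypersurfaceCentreConstruction.LocalEngine

end
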